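import Summits.CriticalPhenomena.CardyFormulaZ2.Statement
import Summits.CriticalPhenomena.SAWScalingLimit.Statement
import Summits.CriticalPhenomena.PercolationContinuityZ3.Statement
import Summits.CriticalPhenomena.Ising3DConformalLimit.Statement
import Literature.Probability.Percolation.CardyFormula
import Literature.Probability.RandomPlanarGeometry.SelfAvoidingWalk
import Literature.Probability.Percolation.CriticalContinuity
import Literature.Probability.LatticeModels.ScalingLimit3D
import HarnessLib

/-!
# CriticalPhenomena — problem statement (D-0013, tier 2; D-0015 statement choice; operator-created)

`CriticalPhenomena := CardyFormulaZ2 ∧ SAWScalingLimit ∧ PercolationContinuityZ3 ∧ Ising3DConformalLimit`.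

* `CardyFormulaZ2` — crossing probabilities of bond percolation on `δℤ²` at `p = 1/2` in every
  conformal rectangle (bounded Jordan domain, four marked boundary points in cyclic order)
  converge, as `δ → 0⁺`, to Cardy's formula `F(η) = 3Γ(2/3)/Γ(1/3)² · η^{1/3} ₂F₁(1/3,2/3;4/3;η)`
  of the cross-ratio `η` of the half-plane preimages of the marks (Cardy 1992, eq. (8)); this is
  the crossing-probability statement of Smirnov 2001, Thm 1 (site percolation on the triangular
  lattice) transplanted to bond percolation on `ℤ²` at `p = 1/2`, the case Smirnov's closing
  remark leaves open. Discretisation: `Literature.Probability.Percolation.discreteCrossing` (largest component `Ω_δ` of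
  `Ω ∩ δℤ²`, closed-edge rule, discrete arc = boundary vertices at least as close to the arc as
  to the rest of `∂Ω`); pointwise limit in the rectangle.
* `SAWScalingLimit` — for every Dobrushin domain `(Ω; a, b)` (bounded Jordan domain, two marked
  boundary points) and every family of lattice endpoints `a_δ → a`, `b_δ → b` joined in
  `Ω_δ ⊆ δℤ²`, the critical-fugacity (`x_c = 1/μ`, `μ` the connective constant of `ℤ²`)
  self-avoiding-walk probability measure on walks of `Ω_δ` from `a_δ` to `b_δ`, seen as curves
  modulo increasing reparametrisation, converges weakly as `δ → 0⁺` to chordal SLE_{8/3} in `Ω`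
  from `a` to `b` (Lawler–Schramm–Werner 2004, §3.4.2 and Prediction 1 of §4.1; in the phrasing of
  Duminil-Copin–Smirnov 2012, Conjecture 1, on `ℤ²`).
* `PercolationContinuityZ3` — `θ(p_c) = 0` for nearest-neighbour bond percolation on `ℤ³`
  (Grimmett 1999, §8 open problem; open for `3 ≤ d ≤ 10`, theorems for `d = 2` and `d ≥ 11`).
* `Ising3DConformalLimit` — the critical nearest-neighbour Ising spin `n`-point functions on
  `δℤ³` (`β = β_c(3)`, `h = 0`, `+` state: the setting of Aizenman–Duminil-Copin–Sidoravicius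
  2015, §1), renormalised by some `ρ(δ) > 0`, converge locally uniformly on non-coincident
  configurations to limits `S` with non-degenerate two-point function, Möbius covariant on
  `ℝ³ ∪ {∞}` with one scaling dimension `Δ > 0` (the covariance reading of "conformal invariance
  of the 3-D Ising critical point", Poland–Rychkov–Vichi 2019, §II eq. (2); shape of
  Chelkak–Hongler–Izyurov 2015, Thm 1.2 / Remark 1.4, transposed to `ℝ³`), and non-Gaussian
  (connected four-point function `U₄ ≢ 0`).

All four conjuncts are Literature statements, imported and not restated; the summit is literally
their conjunction. Open; stated as `Prop`s, never asserted.
-/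

/-- **CriticalPhenomena** (D-0013, tier 2):
`CardyFormulaZ2 ∧ SAWScalingLimit ∧ PercolationContinuityZ3 ∧ Ising3DConformalLimit`.
Cardy's formula for bond percolation on `δℤ²` at `p = 1/2`; the critical-fugacity square-lattice
self-avoiding walk between two boundary points of a Dobrushin domain converges to chordal
SLE_{8/3}; `θ(p_c) = 0` for bond percolation on `ℤ³`; the critical Ising `n`-point functions
on `δℤ³` have non-degenerate, non-Gaussian, Möbius-covariant scaling limits with one scaling
dimension `Δ`. Open; stated as a `Prop`, never asserted (canonical root-level name checked by
the gate). [problem: crit-perc] -/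
def CriticalPhenomena : Prop :=
  CardyFormulaZ2 ∧ SAWScalingLimit ∧ PercolationContinuityZ3 ∧ Ising3DConformalLimit

/-- Unfolding: the summit is the conjunction of the four Literature statements. [folklore] -/
theorem CriticalPhenomena_iff :
    CriticalPhenomena ↔
      Literature.Probability.Percolation.CardyFormulaZ2 ∧ Literature.Probability.RandomPlanarGeometry.SAW.SAWScalingLimit ∧
        Literature.Probability.Percolation.PercolationContinuityZ3 ∧ Literature.Probability.LatticeModels.CritIsing3DConformalLimit :=
  Iff.rfl
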